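import Summits.QuantumFields.BalabanUV.T4Continuum.Support.MinimalActionThm1Type
import Summits.QuantumFields.BalabanUV.T4Continuum.Support.NE3LocalCrudeEnd
import HarnessLib

/-!
# T⁴ programme, node NE3 — BOTH READINGS ON THE FIXED TORUS: `NE3Shape` BY NAME FROM B11 THEOREM 1 TYPE, THE REGIME
# THRESHOLDS AND P2's ROOT T-E (route (A) action half ∘ crude reading (D))

NE3 prover lineage P1, gen 18 (cell `pub-balaban`, unit `b2b-balaban-t4-ne3-p1`, row NE3 OWNER; journal NOTE l.10685).

CONTENT (0 def, 0 sorry): the one-statement composition of the two landed ENDs of this lineage —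
`MinimalActionThm1Type.actionRate_thm1Type_class` (ACTION half, route (A): class family `𝒞 ⊇ sfClass ε` levelwise, regularity
data `0 ≤ b, c ≤ t` under five explicit thresholds `Tᵢ(d,L)·t ≤ 1` and the class-radius condition `18(K_b + K_m)L^{d+2}t ≤ ε`, and
(H∃) = one regular minimiser per level) and `NE3LocalCrudeEnd.ne3Shape_crude_of_actionRate` (LOCAL half, reading (D), crude
fixed-torus route from P2's ROOT T-E = `NE3EnergyShapes.NE3EnergyRate`).  **`ne3Shape_thm1Type_crude`**: at `d = 4` (stated with a
hypothesis `d = 4` so that the thresholds keep their generic displayed form), `L ≥ 2`, `N ≥ 1`: (H∃) in CHOICE form (a selection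
`sel k V` of run-`k` minimisers with `RegularSup d L N b c k (sel k V)`) ∧ T-E ∧ the regime ⇒
`T4EtaRateMin.NE3Shape (minActReadings d 𝒞 L N dom loc_D) (max C_A K_D) (L⁻¹)` BY NAME, where `loc_D k V x = A_{B^k({x})}(sel k V)` is
reading (D) (the Wilson action of the selected level-`k` minimiser over the plaquettes based at the level-`k` sites of the unit cube
at `x ∈ [0,N)^4`), `C_A = wallConstNA(4,L)(gradConst 4 1 + 1)/L²`, `K_D` = the crude (D) constant (`∝ N⁴`).

HONEST FRAMING.  **NE3 is NOT proved**: (H∃) ([Balaban1985Variational] Thm 1 (8)+(9)+(10) p. 279 TYPE, global reading) and T-E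
(`NE3EnergyRate`: leaves ML = B9 Thm 3.3 TYPE, L1∕L2∕L11 printed-TYPE hypotheses of roads P2∕P3; asserted only for the flat class)
are HYPOTHESES; the (D) constant is the crude fixed-torus one (`∝ N⁴`: NOT uniform in the volume — the `N`-uniform (D) needs the
localisation δ ∕ (W2) of roads P2∕P3); each half's hypothesis set is separately witnessed (`actionRate_thm1Type_flat`,
`NE3EnergyShapes.ne3EnergyRate_flat`), joint non-vacuity over one class family is NOT shown here; nothing printed is a hypothesis of a
theorem; no conditional of the cell (`BetaPertH`, (B), (B^μ), G-an2-4); no `def`, no `sorry`, axioms ⊆ {propext, Classical.choice,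
Quot.sound}.  Finite T⁴ rung (B)+1 — NOT infinite volume, NOT a mass gap, NOT the Clay problem, NOT summit progress.  PLACEMENT:
`Summits/QuantumFields/BalabanUV/`.  HONEST DEPENDENCY (cell page 1): continuum YM on T⁴ ⇐ BetaPertH ∧ nine spine estimates (0/9
proved); BetaPertH ⇐ (D1) ∧ (D4) ∧ CAP+tail; G-an2-4 gates asym, D1 and NE2/3/4.
-/

set_option autoImplicit false

open scoped BigOperators Matrix Matrix.Norms.L2Operator
open NormedSpace Finset

namespace Summit.QuantumFields.BalabanUV.T4Continuum.NE3ShapeCrudeTorus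

open Literature.MathematicalPhysics.QuantumFieldTheory.Balaban1983to89
open B7Prop1Explicit B7Prop2Explicit
open T4AveragingDeficitWall hiding Site Plane Plaq Bond
open T4AveragingDeficitWallBoundary (periodBox)
open T4AveragingDeficitNonAbelian (wallConstNA wallConstNA_nonneg wallConstLoc)
open AveragingDeficitDualResidual (dualC1 dualC2)
open AveragingDeficitDerivWallProof (wallConst)
open T4EtaRateMin (NE3Shape)
open MinimalActionSandwich MinimalActionRate MinimalActionRefine
open SkeletonPrecompGrad (gradRem)
open NE3EnergyShapes (NE3EnergyRate)
open MinimalActionThm1Type (actionRate_thm1Type_class)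
open NE3LocalCrudeEnd (ne3Shape_crude_of_actionRate)

noncomputable section

variable {d : ℕ} {n : Type*} [Fintype n] [DecidableEq n] [Nonempty n]

/-- **NE3 BY NAME ON THE FIXED TORUS `T⁴_N`, BOTH READINGS, FROM B11 THEOREM 1 TYPE + THE REGIME + T-E.**  Let `d = 4`, `L ≥ 2`,
`N ≥ 1`, `0 ≤ b, c ≤ t`, `0 ≤ C`, a class family `𝒞 ⊇ sfClass ε` levelwise, the five thresholds `Tᵢ(d,L)·t ≤ 1` and the class-radius
condition of `MinimalActionThm1Type.actionRate_thm1Type_class`; assume (H∃) in choice form — a selection `sel k V` of run-`k`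
minimisers of every datum `V ∈ dom` with sup-form regularity `RegularSup d L N b c k (sel k V)` ([Balaban1985Variational] Thm 1
(8)+(9)+(10) p. 279 TYPE — a HYPOTHESIS) — and P2's ROOT T-E `NE3EnergyRate d 𝒞 L N b (gradConst d c) C dom` (a HYPOTHESIS).  THEN
`NE3Shape (minActReadings d 𝒞 L N dom loc_D) (max C_A K_D) (L⁻¹)`: `0 ≤ L⁻¹ < 1`, `|A_{k+1}(V) − A_k(V)| ≤ max(C_A,K_D)·(L⁻¹)^k·N^4`
and `|loc_D (k+1) V x − loc_D k V x| ≤ max(C_A,K_D)·(L⁻¹)^k` for all `k`, `V ∈ dom`, `x ∈ [0,N)^4`, with reading (D)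
`loc_D k V x = A_{B^k({x})}(sel k V)`.  NE3 is NOT proved by this (two typed hypotheses; crude constant `∝ N⁴`). [folklore] -/
theorem ne3Shape_thm1Type_crude (hd4 : d = 4) {𝒞 : ℕ → Set (Site d → Fin d → (Matrix n n ℂ)ˣ)} {L N : ℕ}
    (hL : 2 ≤ L) (hN : 1 ≤ N) {b c t ε C : ℝ} (hb : 0 ≤ b) (hc : 0 ≤ c) (hbt : b ≤ t) (hct : c ≤ t) (hC : 0 ≤ C)
    (hsub : ∀ j, sfClass d L N ε j ⊆ 𝒞 j)
    (hT1 : (160 * d + 168 * (d : ℝ) ^ 2 + 2 * (32 * d + (24 * d * (2 * (d : ℝ) + gradRem d) + 14336 * (d : ℝ) ^ 2 * ((d : ℝ) + 1) ^ 2)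
            + 12 * (2 * (d : ℝ) + gradRem d))
        + 512 * ((d : ℝ) + 1) * ((d : ℝ) + 4) * (L : ℝ) ^ 2
          * (32 * d + 48 * d * (L : ℝ) ^ 2 * (2 * (d : ℝ) + gradRem d)
            + 8192 * (d : ℝ) ^ 2 * (2 * (d : ℝ) + 1) ^ 2 * (L : ℝ) ^ 2)) * t ≤ 1)
    (hT2 : 2 ^ 15 * ((d : ℝ) + 1) ^ 2 * ((d : ℝ) + 4) ^ 2 * (L : ℝ) ^ 2 * t ≤ 1)
    (hT3 : 2 ^ 14 * ((d : ℝ) + 1) * ((d : ℝ) + 4) * (L : ℝ) ^ (2 * d + 3)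
          * ((32 * d + 48 * d * (L : ℝ) ^ 2 * (2 * (d : ℝ) + gradRem d)
              + 8192 * (d : ℝ) ^ 2 * (2 * (d : ℝ) + 1) ^ 2 * (L : ℝ) ^ 2)
            + (3 * (1280 * d * ((d : ℝ) + 1) ^ 2 * ((d : ℝ) + 4) ^ 2 * (L : ℝ) ^ 2
            * (32 * d + 48 * d * (L : ℝ) ^ 2 * (2 * (d : ℝ) + gradRem d)
              + 8192 * (d : ℝ) ^ 2 * (2 * (d : ℝ) + 1) ^ 2 * (L : ℝ) ^ 2) ^ 2
          + d * ((d : ℝ) + 1) * ((L : ℝ) ^ 3 * (256 * (d : ℝ) ^ 2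
              * (32 * d + (24 * d * (2 * (d : ℝ) + gradRem d) + 14336 * (d : ℝ) ^ 2 * ((d : ℝ) + 1) ^ 2)
                + 12 * (2 * (d : ℝ) + gradRem d))
            + 4 * (24 * d * (2 * (d : ℝ) + gradRem d) + 14336 * (d : ℝ) ^ 2 * ((d : ℝ) + 1) ^ 2)
            + 24 * (2 * (d : ℝ) + gradRem d)))
          + ((d : ℝ) - 1) ^ 2 * (37 * ((d : ℝ) - 1) + 5)))) * t ≤ 1)
    (hT4 : ((32 * d + 48 * d * (L : ℝ) ^ 2 * (2 * (d : ℝ) + gradRem d)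
              + 8192 * (d : ℝ) ^ 2 * (2 * (d : ℝ) + 1) ^ 2 * (L : ℝ) ^ 2)
            + 8 * (3 * (1280 * d * ((d : ℝ) + 1) ^ 2 * ((d : ℝ) + 4) ^ 2 * (L : ℝ) ^ 2
            * (32 * d + 48 * d * (L : ℝ) ^ 2 * (2 * (d : ℝ) + gradRem d)
              + 8192 * (d : ℝ) ^ 2 * (2 * (d : ℝ) + 1) ^ 2 * (L : ℝ) ^ 2) ^ 2
          + d * ((d : ℝ) + 1) * ((L : ℝ) ^ 3 * (256 * (d : ℝ) ^ 2
              * (32 * d + (24 * d * (2 * (d : ℝ) + gradRem d) + 14336 * (d : ℝ) ^ 2 * ((d : ℝ) + 1) ^ 2)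
                + 12 * (2 * (d : ℝ) + gradRem d))
            + 4 * (24 * d * (2 * (d : ℝ) + gradRem d) + 14336 * (d : ℝ) ^ 2 * ((d : ℝ) + 1) ^ 2)
            + 24 * (2 * (d : ℝ) + gradRem d)))
          + ((d : ℝ) - 1) ^ 2 * (37 * ((d : ℝ) - 1) + 5))) * (L : ℝ) ^ (d + 2)) * t ≤ 1)
    (hT5 : (((L : ℝ) ^ 3 * (256 * (d : ℝ) ^ 2
              * (32 * d + (24 * d * (2 * (d : ℝ) + gradRem d) + 14336 * (d : ℝ) ^ 2 * ((d : ℝ) + 1) ^ 2)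
                + 12 * (2 * (d : ℝ) + gradRem d))
            + 4 * (24 * d * (2 * (d : ℝ) + gradRem d) + 14336 * (d : ℝ) ^ 2 * ((d : ℝ) + 1) ^ 2)
            + 24 * (2 * (d : ℝ) + gradRem d)))
            + 36 * (3 * (1280 * d * ((d : ℝ) + 1) ^ 2 * ((d : ℝ) + 4) ^ 2 * (L : ℝ) ^ 2
            * (32 * d + 48 * d * (L : ℝ) ^ 2 * (2 * (d : ℝ) + gradRem d)
              + 8192 * (d : ℝ) ^ 2 * (2 * (d : ℝ) + 1) ^ 2 * (L : ℝ) ^ 2) ^ 2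
          + d * ((d : ℝ) + 1) * ((L : ℝ) ^ 3 * (256 * (d : ℝ) ^ 2
              * (32 * d + (24 * d * (2 * (d : ℝ) + gradRem d) + 14336 * (d : ℝ) ^ 2 * ((d : ℝ) + 1) ^ 2)
                + 12 * (2 * (d : ℝ) + gradRem d))
            + 4 * (24 * d * (2 * (d : ℝ) + gradRem d) + 14336 * (d : ℝ) ^ 2 * ((d : ℝ) + 1) ^ 2)
            + 24 * (2 * (d : ℝ) + gradRem d)))
          + ((d : ℝ) - 1) ^ 2 * (37 * ((d : ℝ) - 1) + 5))) * (L : ℝ) ^ (d + 2)) * t ≤ 1)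
    (hεt : 18 * ((32 * d + 48 * d * (L : ℝ) ^ 2 * (2 * (d : ℝ) + gradRem d)
              + 8192 * (d : ℝ) ^ 2 * (2 * (d : ℝ) + 1) ^ 2 * (L : ℝ) ^ 2)
            + (3 * (1280 * d * ((d : ℝ) + 1) ^ 2 * ((d : ℝ) + 4) ^ 2 * (L : ℝ) ^ 2
            * (32 * d + 48 * d * (L : ℝ) ^ 2 * (2 * (d : ℝ) + gradRem d)
              + 8192 * (d : ℝ) ^ 2 * (2 * (d : ℝ) + 1) ^ 2 * (L : ℝ) ^ 2) ^ 2
          + d * ((d : ℝ) + 1) * ((L : ℝ) ^ 3 * (256 * (d : ℝ) ^ 2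
              * (32 * d + (24 * d * (2 * (d : ℝ) + gradRem d) + 14336 * (d : ℝ) ^ 2 * ((d : ℝ) + 1) ^ 2)
                + 12 * (2 * (d : ℝ) + gradRem d))
            + 4 * (24 * d * (2 * (d : ℝ) + gradRem d) + 14336 * (d : ℝ) ^ 2 * ((d : ℝ) + 1) ^ 2)
            + 24 * (2 * (d : ℝ) + gradRem d)))
          + ((d : ℝ) - 1) ^ 2 * (37 * ((d : ℝ) - 1) + 5)))) * (L : ℝ) ^ (d + 2) * t ≤ ε)
    {dom : Set (Site d → Fin d → (Matrix n n ℂ)ˣ)}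
    {dom : Set (Site d → Fin d → (Matrix n n ℂ)ˣ)} (hTE : NE3EnergyRate d 𝒞 L N b (gradConst d c) C dom)
    {sel : ℕ → (Site d → Fin d → (Matrix n n ℂ)ˣ) → (Site d → Fin d → (Matrix n n ℂ)ˣ)}
    (hmin : ∀ V ∈ dom, ∀ k, IsMinimiser d 𝒞 L N k V (sel k V))
    (hreg : ∀ V ∈ dom, ∀ k, RegularSup d L N b c k (sel k V)) :
    NE3Shape
      (minActReadings d 𝒞 L N dom
        (fun k V (x : ↥(periodBox (d := d) N)) =>
          fineAction (sel k V) (((blockSites L)^[k] {(x : Site d)}) ×ˢ Finset.univ)))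
      (max (wallConstNA d L * (gradConst d 1 + 1) / (L : ℝ) ^ 2)
        (wallConstLoc d L * (2500 * (L : ℝ) ^ 3 * Fintype.card (T4AveragingDeficitWall.Plane d) * (b * c + c ^ 2) + b ^ 3)
          + ((b + 23142400 * b ^ 2) * Real.sqrt (Fintype.card (T4AveragingDeficitWall.Plane d))
              * (C * (wallConst d L * (N : ℝ) ^ 2 * (Real.sqrt (gradConst d c) * dualC2 d L + 2 * b ^ 2 * dualC1 d L)))
            + 14 * Fintype.card (T4AveragingDeficitWall.Plane d)
              * (C * (wallConst d L * (N : ℝ) ^ 2 * (Real.sqrt (gradConst d c) * dualC2 d L + 2 * b ^ 2 * dualC1 d L))) ^ 2)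
        + Fintype.card (T4AveragingDeficitWall.Plane d) * b ^ 2))
      ((L : ℝ)⁻¹) := by
  subst hd4
  have hL1 : 1 ≤ L := le_trans (by norm_num) hL
  have hmin' : ∀ V ∈ dom, ∀ k, ∃ U, IsMinimiser 4 𝒞 L N k V U ∧ RegularSup 4 L N b c k U :=
    fun V hV k => ⟨sel k V, hmin V hV k, hreg V hV k⟩
  have hA := actionRate_thm1Type_class (d := 4) (by norm_num) hL1 hN hb hc hbt hct hsub hT1 hT2 hT3 hT4 hT5 hεt hmin'
    (fun k V (x : ↥(periodBox (d := 4) N)) => fineAction (sel k V) (((blockSites L)^[k] {(x : Site 4)}) ×ˢ Finset.univ))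
  -- the small-field side condition of the local half from threshold (ii)
  have hbs : 20480 * (L : ℝ) ^ 2 * b ≤ 1 := by
    have h2 := hT2
    norm_num at h2
    have hL2 : (0 : ℝ) ≤ (L : ℝ) ^ 2 := by positivity
    have h3 : (L : ℝ) ^ 2 * b ≤ (L : ℝ) ^ 2 * t := mul_le_mul_of_nonneg_left hbt hL2
    have h4 : 0 ≤ (L : ℝ) ^ 2 * b := mul_nonneg hL2 hb
    nlinarith
  have hCA : 0 ≤ wallConstNA 4 L * (gradConst 4 1 + 1) / (L : ℝ) ^ 2 := by
    have := wallConstNA_nonneg (d := 4) L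
    have := gradConst_nonneg (d := 4) (1 : ℝ)
    positivity
  exact ne3Shape_crude_of_actionRate hL hN hb hc hC hbs hTE hmin hreg hCA hA

end

end Summit.QuantumFields.BalabanUV.T4Continuum.NE3ShapeCrudeTorus
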